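import Summits.QuantumAdvantage.QuantumAdvantage.Theorems.LinnikCubicClassGroupsDegreeOnePrimesEscapeRayClassLinnik
import Summits.QuantumAdvantage.QuantumAdvantage.Theorems.LinnikCubicClassGroupsDegreeOnePrimesEscapeRayClassCounting
import HarnessLib

/-!
# Linnik's theorem for cosets of a congruence class group, X: degree-one primes

Topic `Summits/QuantumAdvantage/QuantumAdvantage/Theorems`, cell B2b-1 (linnik-cubic), PART A (gen 23); helper toward
the crux `DegreeOnePrimesEscape` (stmt-QuantumAdvantage-11543) of route `LinnikCubicClassGroups`.  HONEST FRAMING: the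
value of this file is a THEOREM (kernel-checked, GRH-free, Siegel-free) — NOT summit progress (the route still rests on
the hypothesis-type target `PureCubicClassNumberHard`).

For a number field `K` of degree `n > 1`, an abelian Frobenius datum `f : 𝔭 ↦ f 𝔭 ∈ G` killing the narrow ray
`mod 𝔪 ≠ 0` whose non-trivial characters are non-principal off `𝔪`, with `|G| ≤ Q_𝔪⁴`, `Q_𝔪 = |d_K| n^n N𝔪`:
* `exists_degOnePrime_fiber_absNorm_le` — **every coset contains a prime ideal of RESIDUE DEGREE ONE** (`N𝔭 = p` a
  rational prime) with `𝔭 ∤ 𝔪` and `N𝔭 ≤ Q_𝔪^{L(n)}`;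
* `exists_degOnePrime_rayClass_absNorm_le` — the canonical case, UNCONDITIONAL: every narrow ray class `mod 𝔪 ≠ 0` of
  every number field of degree `n` contains a degree-one prime `𝔭 ∤ 𝔪` of norm `≤ (|d_K| n^n N𝔪)^{L(n)}`;
* `closure_primeRayClass_degOne_eq_top` — hence **the narrow ray class group `mod 𝔪` is generated by (indeed, consists
  of the classes of) the degree-one prime ideals `𝔭 ∤ 𝔪` of norm `≤ Q_𝔪^{L(n)}`** — the GRH-free, Siegel-free
  counterpart (with a power of `Q_𝔪` in place of Bach's `O(log² (|d_K| N𝔪))` under GRH) of the small-generator input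
  of class-group / ray-class-group algorithms.
Proof: the relative `θ_τ`-form `thetaFiber_relative` with the repulsion `rayRealZero_repulsion` gives
`θ_τ(x) ≥ c₁(n) x Q_𝔪^{−8}/(8|G|)` at `x = Q_𝔪^L`, `π_τ(x) ≥ θ_τ(x)/log x` (file VIII), and at most `n(√x + 1)` primes
of norm `≤ x` have residue degree `≥ 2` (`ncard_coset_sub_degOne_le`).
References: A. Weiss, J. reine angew. Math. 338 (1983), Thm 6.4 [Weiss1983]; J. Thorner, A. Zaman, ANT 11 (2017),
Thm 3.1 [ThornerZaman2017].
-/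

noncomputable section

open Complex Real Set Filter Topology NumberField IsDedekindDomain
open scoped NumberField nonZeroDivisors

namespace Summit.QuantumAdvantage.QuantumAdvantage.Theorems.DegreeOnePrimesEscape

open Literature.NumberTheory.LFunctions Literature.NumberTheory.LFunctions.NumberField
  Literature.NumberTheory.LFunctions.AbelianDensity Literature.NumberTheory.GaloisRepresentations
open scoped Classical

set_option maxHeartbeats 800000 in
/-- **Linnik's theorem for DEGREE-ONE prime ideals in the cosets of a congruence class group** (see the module
docstring): for `n > 1` there is `L = L(n) > 0` such that, for every datum as above with `|G| ≤ Q_𝔪⁴`, every `τ ∈ G`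
contains a prime `𝔭 ∤ 𝔪` whose norm is a rational prime `≤ Q_𝔪^L`. [cite: Weiss1983, Theorem 6.4]
[cite: ThornerZaman2017, Theorem 3.1] -/
theorem exists_degOnePrime_fiber_absNorm_le (n : ℕ) (hn : 1 < n) :
    ∃ L : ℝ, 0 < L ∧ ∀ (K : Type) [Field K] [NumberField K], Module.finrank ℚ K = n →
    ∀ (G : Type) [CommGroup G] [Finite G] (𝔪 : Ideal (𝓞 K)) (f : HeightOneSpectrum (𝓞 K) → G),
      𝔪 ≠ ⊥ → ArtinKillsRay 𝔪 f →
      (∀ χ : AddChar (Additive G) ℂ, χ ≠ 0 →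
        ∃ v : HeightOneSpectrum (𝓞 K), ¬ 𝔪 ≤ v.asIdeal ∧ χ (Additive.ofMul (f v)) ≠ 1) →
      (Nat.card G : ℝ) ≤ rayCondQ K 𝔪 ^ (4 : ℕ) →
      ∀ τ : G, ∃ v : HeightOneSpectrum (𝓞 K), ¬ 𝔪 ≤ v.asIdeal ∧ f v = τ ∧ (Ideal.absNorm v.asIdeal).Prime ∧
        (Ideal.absNorm v.asIdeal : ℝ) ≤ rayCondQ K 𝔪 ^ L := by
  obtain ⟨a₂, c, ha₂1, hc, hcn, hθ⟩ := thetaFiber_relative n hn (by norm_num : (0 : ℝ) < 1 / 2)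
  obtain ⟨c₁, hc₁, hc₁1, hrep⟩ := rayRealZero_repulsion n hn
  have hn2 : (2 : ℝ) ≤ n := by exact_mod_cast hn
  set L : ℝ := max (max a₂ 56) (92 + 128 / c₁) with hL
  have hLa₂ : a₂ ≤ L := le_trans (le_max_left _ _) (le_max_left _ _)
  have hL56 : (56 : ℝ) ≤ L := le_trans (le_max_right _ _) (le_max_left _ _)
  have hLu : 92 + 128 / c₁ ≤ L := le_max_right _ _
  refine ⟨L, by linarith, fun K _ _ hKn G _ _ 𝔪 f h𝔪 hray hsep hG τ ↦ ?_⟩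
  have hK : 1 < Module.finrank ℚ K := by rw [hKn]; exact hn
  set R : ℝ := rayCondQ K 𝔪 with hR
  have hR12 : (12 : ℝ) ≤ R := twelve_le_rayCondQ hK h𝔪
  have hR1 : (1 : ℝ) < R := by linarith
  have hR0 : (0 : ℝ) < R := by linarith
  have hRne : R ≠ 0 := hR0.ne'
  have hlogR : 2 ≤ Real.log R := two_lt_log_twelve.le.trans (Real.log_le_log (by norm_num) hR12)
  have hlogRR : Real.log R ≤ R := by have := Real.log_le_sub_one_of_pos hR0; linarith
  set x : ℝ := R ^ L with hx
  have hxa₂ : R ^ a₂ ≤ x := Real.rpow_le_rpow_of_exponent_le hR1.le hLa₂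
  have hxR : R ≤ x := by
    have := Real.rpow_le_rpow_of_exponent_le hR1.le (show (1 : ℝ) ≤ L by linarith)
    rwa [Real.rpow_one] at this
  have hx1 : (1 : ℝ) < x := by linarith
  have hx0 : 0 < x := by linarith
  have hlogx : Real.log x = L * Real.log R := by rw [hx, Real.log_rpow hR0]
  have hlogx0 : 0 < Real.log x := Real.log_pos hx1
  have hLlog : 56 * 2 ≤ L * Real.log R := mul_le_mul hL56 hlogR (by norm_num) (by linarith)
  have hlogx1 : 1 ≤ Real.log x := by rw [hlogx]; linarith
  have hL16 : 16 ≤ Real.log x := by rw [hlogx]; linarith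
  have hL92 : 92 < L := by have := div_pos (by norm_num : (0 : ℝ) < 128) hc₁; linarith
  set h : ℝ := (Nat.card G : ℝ) with hh
  have hh1 : 1 ≤ h := by
    rw [hh]; exact_mod_cast Nat.one_le_iff_ne_zero.2 (Nat.card_pos (α := G)).ne'
  have hh0 : 0 < h := by linarith
  have hhQ : h ≤ R ^ 4 := hG
  have hnQ : (Module.finrank ℚ K : ℝ) ≤ R :=
    (ThornerZaman.finrank_le_condQn (K := K)).trans (condQn_le_rayCondQ h𝔪)
  have hRm8' : 0 < R ^ (-(8 : ℝ)) := Real.rpow_pos_of_pos hR0 _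
  have hRm8 : R ^ (-(8 : ℝ)) ≤ 1 := Real.rpow_le_one_of_one_le_of_nonpos hR1.le (by norm_num)
  set m' : ℝ := c₁ * R ^ (-(8 : ℝ)) with hm'
  have hm'0 : 0 < m' := mul_pos hc₁ hRm8'
  have hm'1 : m' ≤ 1 := (mul_le_mul hc₁1 hRm8 hRm8'.le zero_le_one).trans (by norm_num)
  have hm'2 : m' = c₁ * (R ^ 8)⁻¹ := by rw [hm', Real.rpow_neg hR0.le]; norm_cast
  -- Step 1: `θ_τ(x) ≥ x m' / (8 h)`
  have hθlow : x * m' / (8 * h) ≤ fiberTheta 𝔪 f τ x := by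
    have hcmp : x * m' / (8 * h) ≤ x / h - 1 / 2 * x / h := by
      rw [show x / h - 1 / 2 * x / h = x * 4 / (8 * h) by field_simp; ring]
      exact div_le_div_of_nonneg_right (mul_le_mul_of_nonneg_left (by linarith) hx0.le) (by positivity)
    rcases hθ K hKn G 𝔪 f h𝔪 hray hsep hG with hgood | ⟨ψ₁, β₁, hz, hβlow, hβ1, hreal, hexc⟩
    · have h1 := (abs_sub_le_iff.1 (hgood x hxa₂ τ)).2
      linarith
    · obtain ⟨hM0, hb⟩ := hexc x hxa₂ τ
      have h1 := (abs_sub_le_iff.1 hb).2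
      have hδ : m' ≤ 1 - β₁ := hrep K hKn G 𝔪 f h𝔪 hray hsep ψ₁ hreal β₁ hβ1 hz
      have hβ34 : 3 / 4 ≤ β₁ := by
        have hlog4 : 1 < Real.log 4 := by
          rw [show (4:ℝ) = 2 ^ 2 by norm_num, Real.log_pow]; have := Real.log_two_gt_d9; push_cast; linarith
        have hlogd : 0 ≤ Real.log (((discr K).natAbs : ℝ) * ((Ideal.absNorm 𝔪 : ℕ) : ℝ)) :=
          Real.log_nonneg (one_le_discr_mul_absNorm K h𝔪)
        have hc4 : c ≤ 1 / 4 := by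
          refine hcn.trans ?_
          rw [div_le_div_iff_of_pos_left one_pos (by positivity) (by norm_num)]
          have := sq_nonneg (n : ℝ); linarith
        have : c / (Real.log (((discr K).natAbs : ℝ) * ((Ideal.absNorm 𝔪 : ℕ) : ℝ)) + Real.log 4) ≤ 1 / 4 := by
          rw [div_le_iff₀ (by linarith)]; nlinarith
        linarith
      have hr := (addChar_real_apply hreal (Additive.ofMul τ)).2.2
      have hM := sub_mul_rpow_div_ge hx1 hL16 hβ34 hβ1 hr
      have hmin : m' ≤ min 1 ((1 - β₁) * Real.log x) := by
        refine le_min hm'1 (hδ.trans ?_)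
        have := mul_le_mul_of_nonneg_left hlogx1 (by linarith : (0 : ℝ) ≤ 1 - β₁); linarith
      set M : ℝ := x - (ψ₁ (Additive.ofMul τ)).re * x ^ β₁ / β₁ with hMdef
      have hM' : x / 4 * m' ≤ M := le_trans (mul_le_mul_of_nonneg_left hmin (by positivity)) hM
      have h2 : x * m' / (8 * h) ≤ M / h - 1 / 2 * M / h := by
        rw [show M / h - 1 / 2 * M / h = M * 4 / (8 * h) by field_simp; ring]
        exact div_le_div_of_nonneg_right (by linarith) (by positivity)
      linarith
  -- Step 2: `π_τ(x) ≥ θ_τ(x)/log x` and the degree-`≥ 2` count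
  set S : Set (HeightOneSpectrum (𝓞 K)) :=
    {v : HeightOneSpectrum (𝓞 K) | ¬ 𝔪 ≤ v.asIdeal ∧ f v = τ ∧ (Ideal.absNorm v.asIdeal : ℝ) ≤ x} with hSdef
  set S₁ : Set (HeightOneSpectrum (𝓞 K)) :=
    {v : HeightOneSpectrum (𝓞 K) | ¬ 𝔪 ≤ v.asIdeal ∧ f v = τ ∧ (Ideal.absNorm v.asIdeal).Prime ∧
      (Ideal.absNorm v.asIdeal : ℝ) ≤ x} with hS₁def
  have hπ : x * m' / (8 * h) / Real.log x ≤ (S.ncard : ℝ) := by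
    have := fiberTheta_le_card_mul_log (𝔪 := 𝔪) (f := f) τ x
    rw [div_le_iff₀ hlogx0]; linarith
  have hdeg : (S.ncard : ℝ) - (S₁.ncard : ℝ) ≤ (Module.finrank ℚ K : ℝ) * (Real.sqrt x + 1) :=
    ncard_coset_sub_degOne_le (𝔪 := 𝔪) (f := f) τ hx0.le
  -- Step 3: `16 L R¹⁴ < c₁ √x` (`√x = R¹⁴ · R^{L/2 − 14} ≥ R¹⁴ e^{L−28} ≥ R¹⁴ (L−28)²/4`)
  have hsx0 : 0 < Real.sqrt x := Real.sqrt_pos.2 hx0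
  have hxx : Real.sqrt x * Real.sqrt x = x := Real.mul_self_sqrt hx0.le
  have hC : 16 * L * R ^ 14 < c₁ * Real.sqrt x := by
    have hsx : Real.sqrt x = R ^ (14 : ℝ) * R ^ (L / 2 - 14) := by
      rw [Real.sqrt_eq_rpow, hx, ← Real.rpow_mul hR0.le, ← Real.rpow_add hR0]; ring_nf
    have hQ14 : R ^ (14 : ℝ) = R ^ 14 := by norm_cast
    have hexp : Real.exp (L - 28) ≤ R ^ (L / 2 - 14) := by
      rw [Real.rpow_def_of_pos hR0, Real.exp_le_exp]
      have : 2 * (L / 2 - 14) ≤ Real.log R * (L / 2 - 14) :=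
        mul_le_mul_of_nonneg_right hlogR (by linarith)
      linarith
    have hu : (L - 28) ^ 2 / 4 ≤ Real.exp (L - 28) := by
      have h1 := Real.add_one_le_exp ((L - 28) / 2)
      have h2 : Real.exp (L - 28) = Real.exp ((L - 28) / 2) * Real.exp ((L - 28) / 2) := by
        rw [← Real.exp_add]; ring_nf
      rw [h2]
      have h3 : 0 ≤ (L - 28) / 2 + 1 := by linarith
      have h4 := mul_le_mul h1 h1 h3 (Real.exp_pos _).le
      have e : ((L - 28) / 2 + 1) * ((L - 28) / 2 + 1) = (L - 28) ^ 2 / 4 + (L - 28) + 1 := by ring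
      linarith
    have hpoly : 16 * L < c₁ * ((L - 28) ^ 2 / 4) := by
      have hu0 : 64 + 128 / c₁ ≤ L - 28 := by linarith
      have h1 : 16 * c₁ + 32 ≤ c₁ * (L - 28) / 4 := by
        have := mul_le_mul_of_nonneg_left hu0 hc₁.le
        have e : c₁ * (64 + 128 / c₁) = 64 * c₁ + 128 := by field_simp
        linarith
      have h2 : (16 * c₁ + 32) * (L - 28) ≤ c₁ * (L - 28) / 4 * (L - 28) :=
        mul_le_mul_of_nonneg_right h1 (by linarith)
      have h3 : 0 ≤ c₁ * (L - 28) := mul_nonneg hc₁.le (by linarith)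
      have e1 : c₁ * (L - 28) / 4 * (L - 28) = c₁ * ((L - 28) ^ 2 / 4) := by ring
      have e2 : (16 * c₁ + 32) * (L - 28) = 16 * (c₁ * (L - 28)) + 32 * L - 896 := by ring
      linarith
    calc 16 * L * R ^ 14 < c₁ * ((L - 28) ^ 2 / 4) * R ^ 14 := mul_lt_mul_of_pos_right hpoly (pow_pos hR0 14)
      _ ≤ c₁ * R ^ (L / 2 - 14) * R ^ 14 :=
          mul_le_mul_of_nonneg_right (mul_le_mul_of_nonneg_left (hu.trans hexp) hc₁.le) (by positivity)
      _ = c₁ * Real.sqrt x := by rw [hsx, hQ14]; ring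
  -- Step 4: `n (√x + 1) < x m'/(8 h log x)`
  have hkey : (Module.finrank ℚ K : ℝ) * (Real.sqrt x + 1) < x * m' / (8 * h) / Real.log x := by
    have hsqrt1 : 1 ≤ Real.sqrt x := by rw [← Real.sqrt_one]; exact Real.sqrt_le_sqrt hx1.le
    have hA : (Module.finrank ℚ K : ℝ) * (Real.sqrt x + 1) ≤ 2 * R * Real.sqrt x :=
      calc (Module.finrank ℚ K : ℝ) * (Real.sqrt x + 1) ≤ R * (Real.sqrt x + 1) :=
            mul_le_mul_of_nonneg_right hnQ (by positivity)
        _ ≤ R * (2 * Real.sqrt x) := mul_le_mul_of_nonneg_left (by linarith) hR0.le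
        _ = 2 * R * Real.sqrt x := by ring
    have hden : 0 < 8 * h * Real.log x := by positivity
    have hden' : 8 * h * Real.log x ≤ 8 * L * R ^ 5 := by
      rw [hlogx]
      have h1 : h * (L * Real.log R) ≤ R ^ 4 * (L * Real.log R) :=
        mul_le_mul_of_nonneg_right hhQ (by positivity)
      have h2 : R ^ 4 * (L * Real.log R) ≤ R ^ 4 * (L * R) :=
        mul_le_mul_of_nonneg_left (mul_le_mul_of_nonneg_left hlogRR (by linarith)) (by positivity)
      have e1 : 8 * h * (L * Real.log R) = 8 * (h * (L * Real.log R)) := by ring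
      have e2 : 8 * L * R ^ 5 = 8 * (R ^ 4 * (L * R)) := by ring
      rw [e1, e2]; linarith
    have h1 : x * m' / (8 * L * R ^ 5) ≤ x * m' / (8 * h) / Real.log x := by
      rw [div_div]; exact div_le_div_of_nonneg_left (by positivity) hden hden'
    have h2 : 2 * R * Real.sqrt x < x * m' / (8 * L * R ^ 5) := by
      rw [lt_div_iff₀ (by positivity), hm'2]
      have e1 : 2 * R * Real.sqrt x * (8 * L * R ^ 5) = (16 * L * R ^ 14) * Real.sqrt x * (R ^ 8)⁻¹ := by
        field_simp; ring
      have hQ8pos : 0 < (R ^ 8)⁻¹ := by positivity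
      have h3 : (16 * L * R ^ 14) * Real.sqrt x * (R ^ 8)⁻¹ < (c₁ * Real.sqrt x) * Real.sqrt x * (R ^ 8)⁻¹ :=
        mul_lt_mul_of_pos_right (mul_lt_mul_of_pos_right hC hsx0) hQ8pos
      have e3 : (c₁ * Real.sqrt x) * Real.sqrt x * (R ^ 8)⁻¹ = x * (c₁ * (R ^ 8)⁻¹) := by
        rw [mul_assoc c₁, hxx]; ring
      linarith [e1, h3, e3]
    linarith
  -- hence a degree-one prime of the coset exists below `x`
  have hpos : 0 < (S₁.ncard : ℝ) := by linarith
  have hne : S₁.ncard ≠ 0 := by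
    intro h0; rw [h0, Nat.cast_zero] at hpos; exact lt_irrefl _ hpos
  obtain ⟨v, hm, hF, hpr, hle⟩ := Set.nonempty_of_ncard_ne_zero hne
  exact ⟨v, hm, hF, hpr, hle⟩

/-- **The least degree-one prime ideal in a narrow ray class, unconditionally** (canonical case `G = Cl_K^𝔪`,
`f = primeRayClass`): for `n > 1` there is `L = L(n) > 0` such that for every number field `K` of degree `n`, every
`𝔪 ≠ 0` and every narrow ray class `τ mod 𝔪` there is a prime ideal `𝔭 ∤ 𝔪` in `τ` whose norm is a rational prime
`≤ (|d_K| n^n N𝔪)^L`.  GRH-free, Siegel-free, no size hypothesis. [cite: Weiss1983, Theorem 6.4]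
[cite: ThornerZaman2017, Theorem 3.1] -/
theorem exists_degOnePrime_rayClass_absNorm_le (n : ℕ) (hn : 1 < n) :
    ∃ L : ℝ, 0 < L ∧ ∀ (K : Type) [Field K] [NumberField K], Module.finrank ℚ K = n →
    ∀ (𝔪 : Ideal (𝓞 K)) (h𝔪 : 𝔪 ≠ ⊥) (τ : RayClassGroup 𝔪),
      ∃ v : HeightOneSpectrum (𝓞 K), ¬ 𝔪 ≤ v.asIdeal ∧ primeRayClass 𝔪 h𝔪 v = τ ∧
        (Ideal.absNorm v.asIdeal).Prime ∧ (Ideal.absNorm v.asIdeal : ℝ) ≤ rayCondQ K 𝔪 ^ L := by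
  obtain ⟨L, hL, h⟩ := exists_degOnePrime_fiber_absNorm_le n hn
  refine ⟨L, hL, fun K _ _ hKn 𝔪 h𝔪 τ ↦ ?_⟩
  haveI : Finite (RayClassGroup 𝔪) := finite_rayClassGroup h𝔪
  have hK : 1 < Module.finrank ℚ K := by rw [hKn]; exact hn
  exact h K hKn (RayClassGroup 𝔪) 𝔪 (primeRayClass 𝔪 h𝔪) h𝔪 (artinKillsRay_primeRayClass h𝔪)
    (fun χ hχ ↦ exists_charFun_primeRayClass_ne_one h𝔪 χ hχ) (natCard_rayClassGroup_le_rayCondQ_pow hK h𝔪) τ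

/-- **The narrow ray class group `mod 𝔪` is generated by — indeed consists of the classes of — the degree-one prime
ideals `𝔭 ∤ 𝔪` of norm `≤ (|d_K| n^n N𝔪)^{L(n)}`, unconditionally** (GRH-free, Siegel-free small-generator statement;
under GRH the exponent range is Bach's `O(log²(|d_K| N𝔪))`). [cite: Weiss1983, Theorem 6.4] -/
theorem closure_primeRayClass_degOne_eq_top (n : ℕ) (hn : 1 < n) :
    ∃ L : ℝ, 0 < L ∧ ∀ (K : Type) [Field K] [NumberField K], Module.finrank ℚ K = n →
    ∀ (𝔪 : Ideal (𝓞 K)) (h𝔪 : 𝔪 ≠ ⊥),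
      Subgroup.closure (primeRayClass 𝔪 h𝔪 ''
        {v : HeightOneSpectrum (𝓞 K) | ¬ 𝔪 ≤ v.asIdeal ∧ (Ideal.absNorm v.asIdeal).Prime ∧
          (Ideal.absNorm v.asIdeal : ℝ) ≤ rayCondQ K 𝔪 ^ L}) = ⊤ := by
  obtain ⟨L, hL, h⟩ := exists_degOnePrime_rayClass_absNorm_le n hn
  refine ⟨L, hL, fun K _ _ hKn 𝔪 h𝔪 ↦ ?_⟩
  rw [eq_top_iff]
  intro τ _
  obtain ⟨v, hm, hv, hpr, hle⟩ := h K hKn 𝔪 h𝔪 τ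
  exact Subgroup.subset_closure ⟨v, ⟨hm, hpr, hle⟩, hv⟩

end Summit.QuantumAdvantage.QuantumAdvantage.Theorems.DegreeOnePrimesEscape

end
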